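import Literature.Probability.RandomPlanarGeometry.BDGS2012GrahamLongFourier
import HarnessLib

/-!
# Graham's Borel-type bound for `z_c(d)` (BDGS 2012, (1.20)), XII: the tail of the piece series
# is exponentially small in `d`

Sibling file of `Literature.Probability.RandomPlanarGeometry.BDGS2012` (fact
`BDGS2012_Graham_criticalPoint_bound` = Graham 2010, Theorem 1), sequel to
`BDGS2012GrahamLongFourier.lean`. With `q'(k) = max_x c_k(x)` (self-avoiding counts) the marking
inequality and the uniform bound on `H_z^{*(p+1)}` give `C(k-1,p) q'(k) z^k ≤ S_{p+1}`, and the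
elementary binomial estimates of this file turn this into
`Σ_{K₀ ≤ k ≤ A} (k+1) q'(k) z^k ≤ 8 p² S_{p+1} (2p/K₀)^{p-3}` — exponentially small in `d` once
`p ≍ d` and `K₀ ≍ d` with `K₀ ≫ p` (Graham's finite memory `τ` is replaced by this estimate at
`τ = ∞`).

## What is formalised (namespace `Literature.Probability.RandomPlanarGeometry.SAW.Zd.Graham2010`)

* `qSup d k = max_{x} c_k(x)`, `countAt_le_qSup`, `choose_mul_qSup_mul_pow_le`
  (`C(k-1,p) q'(k) z^k ≤ (16^{p+1}+1)(K(K+‖Π_z‖₁))^{p+1}`);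
* binomial bookkeeping: `inv_choose_eq_telescope` (`1/C(j,q) = (q/(q-1))(1/C(j-1,q-1) - 1/C(j,q-1))`),
  `sum_inv_choose_le`, `succ_div_choose_le` (`(k+1)/C(k-1,p) ≤ 4p(p-1)/C(k-1,p-2)` for `k ≥ 2p`),
  `inv_choose_le_pow` (`1/C(n,q) ≤ (q/(n+1-q))^q`);
* **`tail_weight_le`** — `Σ_{k=K₀}^{A} (k+1) q'(k) z^k ≤ 8 p² S_{p+1} (2p/K₀)^{p-3}` for `p ≥ 4`,
  `K₀ ≥ 2p + 2`, `d ≥ 6(p+1) + 1`, `0 < z < z_c` under `f₁, f₂ ≤ K`.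
-/

noncomputable section

open Finset Filter Topology MeasureTheory
open scoped BigOperators ENNReal
open Literature.Probability.LatticeModels Literature.Probability.LatticeModels.SRW
open Literature.Barriers.CriticalPhenomena Literature.Barriers.CriticalPhenomena.SAWLace
open Literature.Probability.RandomPlanarGeometry.LaceExpansion (laceCoeff lacePi)

namespace Literature.Probability.RandomPlanarGeometry.SAW.Zd.Graham2010

variable {d : ℕ}

/-! ### `q'(k) = max_x c_k(x)` -/

/-- `qSup d k = max_x c_k(x)` (the maximum over the finite box reached in `k` steps).
[cite: Graham2010, Section 5 (the sup in `F_β^τ`)] -/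
def qSup (d k : ℕ) : ℕ := (box d k).sup fun x => countAt d k x

/-- `c_k(x) ≤ qSup d k`. [folklore] -/
theorem countAt_le_qSup (k : ℕ) (x : Site d) : countAt d k x ≤ qSup d k := by
  classical
  by_cases hx : x ∈ box d k
  · exact Finset.le_sup (f := fun x => countAt d k x) hx
  · rw [countAt_eq_zero_of_not_mem_box hx]; exact Nat.zero_le _

/-- The maximum is attained. [folklore] -/
theorem exists_qSup_eq (k : ℕ) : ∃ x : Site d, qSup d k = countAt d k x := by
  obtain ⟨x, -, hx⟩ := Finset.exists_mem_eq_sup (box d k) ⟨0, zero_mem_box d k⟩ (fun x => countAt d k x)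
  exact ⟨x, hx⟩

/-- **`C(k-1, p) q'(k) z^k ≤ S_{p+1} = (16^{p+1} + 1)(K(K + ‖Π_z‖₁))^{p+1}`** for `k ≥ p + 1`,
`d ≥ 6(p+1) + 1`, `0 < z < z_c` under `f₁, f₂ ≤ K` (marking inequality, `chainCount ≤ H^{*(p+1)}`,
and `convPow_le`). [cite: Graham2010, Section 5] -/
theorem choose_mul_qSup_mul_pow_le {p : ℕ} (hd : 6 * (p + 1) + 1 ≤ d) {z : ℝ} (hz : 0 < z)
    (hzc : z < criticalPoint d) {K : ℝ} (hboot : Boot d K z)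
    (hπ : Summable fun q : ℕ × Site d => |laceCoeff d 1 q.1 q.2| * z ^ q.1) {k : ℕ} (hk : p + 1 ≤ k) :
    (((k - 1).choose p : ℕ) : ℝ) * (qSup d k : ℝ) * z ^ k ≤
      (16 ^ (p + 1) + 1) * (K * (K + ∑' x, |lacePi d 1 z x|)) ^ (p + 1) := by
  obtain ⟨x, hx⟩ := exists_qSup_eq (d := d) k
  rw [hx]
  calc (((k - 1).choose p : ℕ) : ℝ) * (countAt d k x : ℝ) * z ^ k
      = ((((k - 1).choose p * countAt d k x : ℕ)) : ℝ) * z ^ k := by push_cast; ring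
    _ ≤ (chainCount d (p + 1) k x : ℝ) * z ^ k := by
        refine mul_le_mul_of_nonneg_right ?_ (by positivity)
        exact_mod_cast choose_mul_countAt_le_chainCount p k x hk
    _ ≤ convPow d z (p + 1) x := chainCount_mul_pow_le_convPow hz hzc (p + 1) k x
    _ ≤ _ := convPow_le hd hz hzc hboot hπ x

/-! ### Binomial bookkeeping -/

/-- `1/C(j,q) = (q/(q-1)) · (1/C(j-1,q-1) - 1/C(j,q-1))` for `2 ≤ q ≤ j`. [folklore] -/
theorem inv_choose_eq_telescope {q j : ℕ} (hq : 2 ≤ q) (hj : q ≤ j) :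
    (1 : ℝ) / (j.choose q : ℝ) =
      ((q : ℝ) / ((q : ℝ) - 1)) * (1 / ((j - 1).choose (q - 1) : ℝ) - 1 / (j.choose (q - 1) : ℝ)) := by
  obtain ⟨q', rfl⟩ : ∃ q', q = q' + 1 := ⟨q - 1, by omega⟩
  obtain ⟨j', rfl⟩ : ∃ j', j = j' + 1 := ⟨j - 1, by omega⟩
  simp only [Nat.add_sub_cancel]
  -- `C(j'+1, q'+1) (q'+1) = (j'+1) C(j', q')` and `C(j'+1, q') (j'+1-q') = (j'+1) C(j', q')`
  have h1 : ((j' + 1).choose (q' + 1) : ℝ) * (q' + 1) = (j' + 1) * (j'.choose q' : ℝ) := by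
    have h := Nat.add_one_mul_choose_eq j' q'
    exact_mod_cast h.symm
  have hq'j : q' ≤ j' + 1 := by omega
  have h2 : ((j' + 1).choose q' : ℝ) * ((j' : ℝ) + 1 - q') = (j' + 1) * (j'.choose q' : ℝ) := by
    have h := Nat.choose_mul_succ_eq j' q'
    have h' : ((((j' + 1).choose q') * (j' + 1 - q') : ℕ) : ℝ) = ((j'.choose q' * (j' + 1) : ℕ) : ℝ) := by
      exact_mod_cast h.symm
    push_cast [Nat.cast_sub hq'j] at h'
    linarith
  have hpos1 : (0 : ℝ) < j'.choose q' := by exact_mod_cast Nat.choose_pos (by omega)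
  have hpos2 : (0 : ℝ) < (j' + 1).choose (q' + 1) := by exact_mod_cast Nat.choose_pos (by omega)
  have hpos3 : (0 : ℝ) < (j' + 1).choose q' := by exact_mod_cast Nat.choose_pos (by omega)
  have hq1 : (0 : ℝ) < q' := by exact_mod_cast (show 0 < q' by omega)
  have hjq : (0 : ℝ) < (j' : ℝ) + 1 - q' := by
    have : (q' : ℝ) ≤ j' := by exact_mod_cast (show q' ≤ j' by omega)
    linarith
  push_cast
  rw [show ((q' : ℝ) + 1 - 1) = q' by ring]
  field_simp
  nlinarith [h1, h2]

/-- The telescoped sum: `Σ_{i<L} 1/C(J+i, q) ≤ (q/(q-1)) / C(J-1, q-1)` for `2 ≤ q ≤ J`. [folklore] -/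
theorem sum_inv_choose_le {q J : ℕ} (hq : 2 ≤ q) (hJ : q ≤ J) (L : ℕ) :
    ∑ i ∈ Finset.range L, (1 : ℝ) / ((J + i).choose q : ℝ) ≤
      ((q : ℝ) / ((q : ℝ) - 1)) / ((J - 1).choose (q - 1) : ℝ) := by
  set f : ℕ → ℝ := fun i => 1 / ((J - 1 + i).choose (q - 1) : ℝ) with hf
  have hterm : ∀ i ∈ Finset.range L, (1 : ℝ) / ((J + i).choose q : ℝ) =
      ((q : ℝ) / ((q : ℝ) - 1)) * (f i - f (i + 1)) := by
    intro i _
    rw [inv_choose_eq_telescope hq (by omega)]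
    simp only [hf]
    rw [show J + i - 1 = J - 1 + i by omega, show J - 1 + (i + 1) = J + i by omega]
  rw [Finset.sum_congr rfl hterm, ← Finset.mul_sum, Finset.sum_range_sub']
  have hq1 : (0 : ℝ) < (q : ℝ) - 1 := by
    have : (2 : ℝ) ≤ q := by exact_mod_cast hq
    linarith
  have hfL : 0 ≤ f L := by simp only [hf]; positivity
  rw [div_eq_mul_one_div ((q : ℝ) / _)]
  refine mul_le_mul_of_nonneg_left ?_ (by positivity)
  simp only [hf, Nat.add_zero]
  linarith

/-- `(k+1)/C(k-1,p) ≤ 4p(p-1)/C(k-1,p-2)` for `p ≥ 4` and `k ≥ 2p`. [folklore] -/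
theorem succ_div_choose_le {p k : ℕ} (hp : 4 ≤ p) (hk : 2 * p ≤ k) :
    ((k : ℝ) + 1) / ((k - 1).choose p : ℝ) ≤ 4 * (p : ℝ) * ((p : ℝ) - 1) / ((k - 1).choose (p - 2) : ℝ) := by
  obtain ⟨q, rfl⟩ : ∃ q, p = q + 2 := ⟨p - 2, by omega⟩
  obtain ⟨n, hn⟩ : ∃ n, k - 1 = n := ⟨_, rfl⟩
  rw [hn, Nat.add_sub_cancel]
  -- `C(n, q+2) (q+1)(q+2) = C(n, q) (n-q)(n-q-1)`
  have hrel : (n.choose (q + 2) : ℝ) * ((q + 1) * (q + 2)) = (n.choose q : ℝ) * ((n - q) * (n - q - 1) : ℕ) := by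
    have h1 := Nat.choose_mul_succ_eq n (q + 1)   -- C(n, q+1) * (n+1 ... ) hmm
    -- use `Nat.choose_succ_right_eq : n.choose (k+1) * (k+1) = n.choose k * (n - k)`
    have e1 := Nat.choose_succ_right_eq n (q + 1)
    have e2 := Nat.choose_succ_right_eq n q
    have : n.choose (q + 2) * ((q + 1) * (q + 2)) = n.choose q * ((n - q) * (n - q - 1)) := by
      calc n.choose (q + 2) * ((q + 1) * (q + 2)) = (n.choose (q + 1 + 1) * (q + 1 + 1)) * (q + 1) := by ring
        _ = n.choose (q + 1) * (n - (q + 1)) * (q + 1) := by rw [e1]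
        _ = (n.choose (q + 1) * (q + 1)) * (n - (q + 1)) := by ring
        _ = n.choose q * (n - q) * (n - (q + 1)) := by rw [e2]
        _ = n.choose q * ((n - q) * (n - q - 1)) := by rw [Nat.sub_add_eq]; ring
    exact_mod_cast this
  have hnq : 2 * q + 3 ≤ n := by omega
  have hpos : (0 : ℝ) < n.choose (q + 2) := by exact_mod_cast Nat.choose_pos (by omega)
  have hpos' : (0 : ℝ) < n.choose q := by exact_mod_cast Nat.choose_pos (by omega)
  have hcast : (((n - q) * (n - q - 1) : ℕ) : ℝ) = ((n : ℝ) - q) * ((n : ℝ) - q - 1) := by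
    rw [Nat.cast_mul, Nat.cast_sub (by omega), Nat.cast_sub (by omega), Nat.cast_sub (by omega)]
    push_cast; ring
  rw [hcast] at hrel
  rw [div_le_div_iff₀ hpos hpos']
  -- `(k+1) C(n,q) ≤ 4 (q+2)(q+1) C(n,q+2)` with `k + 1 = n + 2`
  have hk1 : (k : ℝ) + 1 = n + 2 := by
    have : k = n + 1 := by omega
    rw [this]; push_cast; ring
  rw [hk1]
  have hq0 : (0 : ℝ) ≤ q := Nat.cast_nonneg q
  have hn0 : (2 : ℝ) * q + 3 ≤ n := by exact_mod_cast hnq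
  -- `(n+2) ≤ 4 (n-q)(n-q-1)/( (q+1)(q+2) ) * (q+2)(q+1)/... ` : use `hrel`
  have key : ((n : ℝ) + 2) * (n.choose q : ℝ) * ((q + 1) * (q + 2)) ≤
      4 * ((q : ℝ) + 2) * ((q : ℝ) + 2 - 1) * (n.choose (q + 2) : ℝ) * ((q + 1) * (q + 2)) := by
    rw [show 4 * ((q : ℝ) + 2) * ((q : ℝ) + 2 - 1) * (n.choose (q + 2) : ℝ) * ((q + 1) * (q + 2)) =
      4 * ((q : ℝ) + 2) * ((q : ℝ) + 1) * ((n.choose (q + 2) : ℝ) * ((q + 1) * (q + 2))) by ring, hrel]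
    have h4 : (n : ℝ) + 2 ≤ 4 * (((n : ℝ) - q) * ((n : ℝ) - q - 1)) := by nlinarith
    have hc0 : 0 ≤ (n.choose q : ℝ) * ((q + 1) * (q + 2)) := by positivity
    calc ((n : ℝ) + 2) * (n.choose q : ℝ) * ((q + 1) * (q + 2))
        = ((n : ℝ) + 2) * ((n.choose q : ℝ) * ((q + 1) * (q + 2))) := by ring
      _ ≤ (4 * (((n : ℝ) - q) * ((n : ℝ) - q - 1))) * ((n.choose q : ℝ) * ((q + 1) * (q + 2))) :=
          mul_le_mul_of_nonneg_right h4 hc0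
      _ ≤ 4 * ((q : ℝ) + 2) * ((q : ℝ) + 1) * ((n.choose q : ℝ) * (((n : ℝ) - q) * ((n : ℝ) - q - 1))) := by
          have : (1 : ℝ) ≤ ((q : ℝ) + 2) * ((q : ℝ) + 1) := by nlinarith
          have hc1 : 0 ≤ (n.choose q : ℝ) * (((n : ℝ) - q) * ((n : ℝ) - q - 1)) := by
            rw [← hrel]; positivity
          nlinarith
  have hqq : (0 : ℝ) < (q + 1) * (q + 2) := by positivity
  push_cast
  nlinarith [key, hqq]

/-- `1/C(n,q) ≤ (q/(n+1-q))^q` for `q ≤ n` (from `C(n,q) ≥ (n+1-q)^q/q!` and `q! ≤ q^q`). [folklore] -/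
theorem inv_choose_le_pow {q n : ℕ} (hqn : q ≤ n) :
    (1 : ℝ) / (n.choose q : ℝ) ≤ ((q : ℝ) / ((n : ℝ) + 1 - q)) ^ q := by
  have h := Nat.pow_le_choose (α := ℝ) q n
  have hpos : (0 : ℝ) < n.choose q := by exact_mod_cast Nat.choose_pos hqn
  have hm : (0 : ℝ) < (n : ℝ) + 1 - q := by
    have : (q : ℝ) ≤ n := by exact_mod_cast hqn
    linarith
  have hcast : (((n + 1 - q : ℕ) ^ q : ℕ) : ℝ) = ((n : ℝ) + 1 - q) ^ q := by
    rw [Nat.cast_pow, Nat.cast_sub (by omega)]; push_cast; ring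
  have hfact : ((q.factorial : ℕ) : ℝ) ≤ (q : ℝ) ^ q := by exact_mod_cast Nat.factorial_le_pow q
  have hfpos : (0 : ℝ) < q.factorial := by exact_mod_cast Nat.factorial_pos q
  rw [div_le_iff₀ hpos, div_pow, div_mul_eq_mul_div, le_div_iff₀ (by positivity), one_mul]
  -- `(n+1-q)^q ≤ q^q C(n,q)` from `(n+1-q)^q / q! ≤ C(n,q)` and `q! ≤ q^q`
  have h' : ((n : ℝ) + 1 - q) ^ q ≤ (q.factorial : ℝ) * (n.choose q : ℝ) := by
    have := h
    rw [show (((n + 1 - q : ℕ) : ℝ) ^ q) = ((n : ℝ) + 1 - q) ^ q by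
      rw [Nat.cast_sub (by omega)]; push_cast; ring] at this
    rwa [div_le_iff₀ hfpos, mul_comm] at this
  calc ((n : ℝ) + 1 - q) ^ q ≤ (q.factorial : ℝ) * (n.choose q : ℝ) := h'
    _ ≤ (q : ℝ) ^ q * (n.choose q : ℝ) := mul_le_mul_of_nonneg_right hfact hpos.le

/-! ### The tail of the piece series -/

/-- **The tail estimate**: for `p ≥ 4`, `K₀ ≥ 2p + 2`, `d ≥ 6(p+1) + 1`, `0 < z < z_c` under
`f₁, f₂ ≤ K`, with `S = (16^{p+1}+1)(K(K+‖Π_z‖₁))^{p+1}`: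
`Σ_{k=K₀}^{A} (k+1) q'(k) z^k ≤ 8 p² S (2p/K₀)^{p-3}`. With `p ≍ d`, `K₀ ≍ d`, `K₀ ≥ 4ep` this is
exponentially small in `d` — the substitute, at infinite memory, for Graham's use of a finite memory
`τ` and Kesten's bound on `|μ - μ_τ|`. [cite: Graham2010, Section 5] -/
theorem tail_weight_le {p : ℕ} (hp : 4 ≤ p) (hd : 6 * (p + 1) + 1 ≤ d) {z : ℝ} (hz : 0 < z)
    (hzc : z < criticalPoint d) {K : ℝ} (hboot : Boot d K z)
    (hπ : Summable fun q : ℕ × Site d => |laceCoeff d 1 q.1 q.2| * z ^ q.1) {K₀ : ℕ}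
    (hK₀ : 2 * p + 2 ≤ K₀) (A : ℕ) :
    ∑ k ∈ Finset.Icc K₀ A, ((k : ℝ) + 1) * (qSup d k : ℝ) * z ^ k ≤
      8 * (p : ℝ) ^ 2 * ((16 ^ (p + 1) + 1) * (K * (K + ∑' x, |lacePi d 1 z x|)) ^ (p + 1)) *
        (2 * (p : ℝ) / K₀) ^ (p - 3) := by
  set S : ℝ := (16 ^ (p + 1) + 1) * (K * (K + ∑' x, |lacePi d 1 z x|)) ^ (p + 1) with hS
  have hK' : 0 ≤ K := le_trans (by positivity) hboot.f1
  have hP0 : 0 ≤ ∑' x, |lacePi d 1 z x| := tsum_nonneg fun x => abs_nonneg _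
  have hS0 : 0 ≤ S := by positivity
  have hp0 : (0 : ℝ) < p := by exact_mod_cast (show 0 < p by omega)
  have hK₀0 : (0 : ℝ) < K₀ := by exact_mod_cast (show 0 < K₀ by omega)
  -- Step 1: termwise
  have hterm : ∀ k ∈ Finset.Icc K₀ A, ((k : ℝ) + 1) * (qSup d k : ℝ) * z ^ k ≤
      (4 * (p : ℝ) * ((p : ℝ) - 1) / ((k - 1).choose (p - 2) : ℝ)) * S := by
    intro k hk
    rw [Finset.mem_Icc] at hk
    have hkp : p + 1 ≤ k := by omega
    have hcpos : (0 : ℝ) < ((k - 1).choose p : ℝ) := by exact_mod_cast Nat.choose_pos (by omega)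
    have h1 := choose_mul_qSup_mul_pow_le hd hz hzc hboot hπ hkp
    rw [← hS] at h1
    calc ((k : ℝ) + 1) * (qSup d k : ℝ) * z ^ k
        = (((k : ℝ) + 1) / ((k - 1).choose p : ℝ)) * ((((k - 1).choose p : ℕ) : ℝ) * (qSup d k : ℝ) * z ^ k) := by
          field_simp
      _ ≤ (((k : ℝ) + 1) / ((k - 1).choose p : ℝ)) * S :=
          mul_le_mul_of_nonneg_left h1 (by positivity)
      _ ≤ (4 * (p : ℝ) * ((p : ℝ) - 1) / ((k - 1).choose (p - 2) : ℝ)) * S :=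
          mul_le_mul_of_nonneg_right (succ_div_choose_le hp (by omega)) hS0
  -- Step 2: the telescoped sum
  have hsum : ∑ k ∈ Finset.Icc K₀ A, (1 : ℝ) / ((k - 1).choose (p - 2) : ℝ) ≤
      (((p - 2 : ℕ) : ℝ) / (((p - 2 : ℕ) : ℝ) - 1)) / ((K₀ - 1 - 1).choose (p - 2 - 1) : ℝ) := by
    rw [← Finset.Ico_add_one_right_eq_Icc, Finset.sum_Ico_eq_sum_range]
    have h := sum_inv_choose_le (q := p - 2) (J := K₀ - 1) (by omega) (by omega) (A + 1 - K₀)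
    refine le_trans (le_of_eq (Finset.sum_congr rfl fun i _ => ?_)) h
    rw [show K₀ + i - 1 = K₀ - 1 + i by omega]
  have hratio : (((p - 2 : ℕ) : ℝ) / (((p - 2 : ℕ) : ℝ) - 1)) ≤ 2 := by
    rw [Nat.cast_sub (by omega)]
    push_cast
    rw [div_le_iff₀ (by
      have : (4 : ℝ) ≤ p := by exact_mod_cast hp
      linarith)]
    have : (4 : ℝ) ≤ p := by exact_mod_cast hp
    linarith
  -- Step 3: the last binomial
  have hlast : (1 : ℝ) / ((K₀ - 1 - 1).choose (p - 2 - 1) : ℝ) ≤ (2 * (p : ℝ) / K₀) ^ (p - 3) := by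
    rw [show K₀ - 1 - 1 = K₀ - 2 by omega, show p - 2 - 1 = p - 3 by omega]
    refine (inv_choose_le_pow (q := p - 3) (n := K₀ - 2) (by omega)).trans ?_
    have hbase : (((p - 3 : ℕ) : ℝ) / (((K₀ - 2 : ℕ) : ℝ) + 1 - ((p - 3 : ℕ) : ℝ))) ≤ 2 * (p : ℝ) / K₀ := by
      rw [Nat.cast_sub (by omega), Nat.cast_sub (by omega)]
      push_cast
      have hden : (0 : ℝ) < (K₀ : ℝ) - 2 + 1 - ((p : ℝ) - 3) := by
        have : (2 : ℝ) * p + 2 ≤ K₀ := by exact_mod_cast hK₀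
        linarith
      rw [div_le_div_iff₀ hden hK₀0]
      have : (2 : ℝ) * p + 2 ≤ K₀ := by exact_mod_cast hK₀
      have : (4 : ℝ) ≤ p := by exact_mod_cast hp
      nlinarith
    have hb0 : 0 ≤ (((p - 3 : ℕ) : ℝ) / (((K₀ - 2 : ℕ) : ℝ) + 1 - ((p - 3 : ℕ) : ℝ))) := by
      apply div_nonneg (Nat.cast_nonneg _)
      rw [Nat.cast_sub (by omega), Nat.cast_sub (by omega)]
      push_cast
      have : (2 : ℝ) * p + 2 ≤ K₀ := by exact_mod_cast hK₀
      have : (4 : ℝ) ≤ p := by exact_mod_cast hp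
      linarith
    exact pow_le_pow_left₀ hb0 hbase (p - 3)
  -- assemble
  have hchoose0 : 0 ≤ (1 : ℝ) / ((K₀ - 1 - 1).choose (p - 2 - 1) : ℝ) := by positivity
  calc ∑ k ∈ Finset.Icc K₀ A, ((k : ℝ) + 1) * (qSup d k : ℝ) * z ^ k
      ≤ ∑ k ∈ Finset.Icc K₀ A, (4 * (p : ℝ) * ((p : ℝ) - 1) / ((k - 1).choose (p - 2) : ℝ)) * S :=
        Finset.sum_le_sum hterm
    _ = (4 * (p : ℝ) * ((p : ℝ) - 1) * S) * ∑ k ∈ Finset.Icc K₀ A, (1 : ℝ) / ((k - 1).choose (p - 2) : ℝ) := by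
        rw [Finset.mul_sum]
        exact Finset.sum_congr rfl fun k _ => by ring
    _ ≤ (4 * (p : ℝ) * ((p : ℝ) - 1) * S) * (2 * (2 * (p : ℝ) / K₀) ^ (p - 3)) := by
        refine mul_le_mul_of_nonneg_left (hsum.trans ?_) ?_
        · rw [div_eq_mul_one_div]
          exact mul_le_mul hratio hlast hchoose0 (by norm_num)
        · have : (1 : ℝ) ≤ p := by exact_mod_cast (show 1 ≤ p by omega)
          have : 0 ≤ (p : ℝ) - 1 := by linarith
          positivity
    _ ≤ 8 * (p : ℝ) ^ 2 * S * (2 * (p : ℝ) / K₀) ^ (p - 3) := by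
        have hpow : 0 ≤ (2 * (p : ℝ) / K₀) ^ (p - 3) := by positivity
        have : (p : ℝ) * ((p : ℝ) - 1) ≤ (p : ℝ) ^ 2 := by nlinarith
        nlinarith [mul_nonneg hS0 hpow]

end Literature.Probability.RandomPlanarGeometry.SAW.Zd.Graham2010
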